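import Literature.MathematicalPhysics.QuantumManyBody.GroundState
import Literature.MathematicalPhysics.QuantumManyBody.BoseGasCatStates
import Summits.AtomisticToContinuum.BoseEinsteinCondensation.Theorems.BECCutLineWeakDisorderGroundStateRigidityReduction
import Summits.AtomisticToContinuum.BoseEinsteinCondensation.Theorems.BECHeatBathGapIdealGasTensorisation
import Summits.AtomisticToContinuum.BoseEinsteinCondensation.Theorems.BECConjugateDominationHardCoreExtensionMaxFormApproximationFiniteRangeBookkeeping

/-!
# Crux `BoundaryTransferWeak` (stmt-AtomisticToContinuum-0827), line `Sketch`
# (idea `coupled-bath-relocation`): stub S2b — the free Dirichlet ground state is the sine product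

For the FREE gas (`v = 0`) in the Dirichlet box `Λ_L = (0, L)³` the tree's nonnegative ground state
`groundState 0 N L` (the Perron–Frobenius representative chosen in `GroundState.lean`) is, almost
everywhere, the tensor power `u_L^{⊗N}` of the normalised sine mode
`u_L(x) = ∏ₖ √(2/L) sin(π xₖ / L)` (extended by `0` off the box).  The statement is conditional on
the two neighbouring stubs of the line, taken as hypotheses verbatim:

* S1 (`stub_freeDirichletGap`): the sharp free Dirichlet bound `⟨Ψ, -ΔΨ⟩ ≥ 3N(π/L)²` on the `C¹`
  core;
* S2a (`stub_freeOneBodyApprox`): `C¹` one-body Dirichlet approximants `φ_ε` of `u_L` with energy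
  `≤ 3(π/L)² + ε` and `‖φ_ε - u_L‖² ≤ ε`.

Proof (`FreeGroundState.groundState_ae_eq_prod`, stated for any nonnegative measurable Dirichlet
mode `u` with such approximants and the matching `N`-body lower bound `N e ≤ E`).  The power states
`φ_ε^{⊗N}` (`exists_powerState`, built on `BoseGas.powFun` as in `BoseGasCatStates`) are trial
states with energies `N · energy φ_ε ≤ N(e + ε)` (`rawEnergy_zero_powFun`) and converge to `u^{⊗N}`
in `L²`: for normalised modes `‖a^{⊗(n+1)} - b^{⊗(n+1)}‖² ≤ 2‖a^{⊗n} - b^{⊗n}‖² + 2‖a - b‖²`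
(pointwise parallelogram bound and Fubini, `lintegral_mul_split`), whence
`‖a^{⊗n} - b^{⊗n}‖² ≤ 4ⁿ‖a - b‖²` (`lintegral_powFun_sub_sq_le`; `‖u‖ = 1` itself follows from the
approximants, `u` being an `L²`-limit of normalised states).  With the lower bound, `liminf` of the
energies is `≤ N e ≤ E₀(N, L)`, so `u^{⊗N}` is a ground state (`IsGroundState.of_tendstoL2`).
Ground states of bounded potentials are unique up to a phase
(`GroundStateRigidity.hasUniqueGroundState_of_bounded` at `v = 0`), so
`u^{⊗N} = c · groundState 0 N L` a.e. with `|c| = 1`; both functions being real and nonnegative,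
taking moduli pins the phase: `groundState 0 N L = u^{⊗N}` a.e.  The stub is the instance
`u = u_L`, `e = 3(π/L)²`.
No definitions are introduced; the one-body-mode bookkeeping (`oneFun_mode`, `contDiff_oneFun_mode`,
`lintegral_oneFun_mode_sq`, `continuous_mode`, `powFun_mode_eq_zero`) is reused from
`Theorems.IdealGasTensorisation` and `|a + b|² ≤ 2|a|² + 2|b|²` from
`Cruxes.HardCoreExtension.NearMinTower.nnnorm_add_sq_le`.

## References

* [LSSY2005] E. H. Lieb, R. Seiringer, J. P. Solovej, J. Yngvason, *The Mathematics of the Bose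
  Gas and its Condensation* (2005), §1.2 and Ch. 7 (the nonnegative normalised ground state).
* [ReedSimonIV1978] M. Reed, B. Simon, *Methods of Modern Mathematical Physics IV*, §XIII.12
  Thms XIII.46–XIII.47 (nondegeneracy of the ground state).
-/

noncomputable section

namespace Summit.AtomisticToContinuum.BoseEinsteinCondensation.CoupledBaths

open Literature.MathematicalPhysics.QuantumManyBody.BoseGas
open MeasureTheory Filter
open scoped ENNReal NNReal Topology

namespace FreeGroundState

open Summit.AtomisticToContinuum.BoseEinsteinCondensation.Theorems.IdealGasTensorisation

/-! ### Pointwise and measurability bookkeeping -/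

/-- `‖A₁A₂ - B₁B₂‖² ≤ 2‖A₁ - B₁‖² ‖A₂‖² + 2‖B₁‖² ‖A₂ - B₂‖²` in `ℝ≥0∞`
(`A₁A₂ - B₁B₂ = (A₁ - B₁)A₂ + B₁(A₂ - B₂)`). [folklore] -/
theorem ennnorm_mul_sub_mul_sq_le (A₁ A₂ B₁ B₂ : ℂ) :
    ((‖A₁ * A₂ - B₁ * B₂‖₊ : ℝ≥0∞)) ^ 2 ≤
      2 * ((‖A₁ - B₁‖₊ : ℝ≥0∞) ^ 2 * (‖A₂‖₊ : ℝ≥0∞) ^ 2) +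
        2 * ((‖B₁‖₊ : ℝ≥0∞) ^ 2 * (‖A₂ - B₂‖₊ : ℝ≥0∞) ^ 2) := by
  have e : A₁ * A₂ - B₁ * B₂ = (A₁ - B₁) * A₂ + B₁ * (A₂ - B₂) := by ring
  rw [e, ← ennnorm_mul_sq, ← ennnorm_mul_sq]
  exact Summit.AtomisticToContinuum.BoseEinsteinCondensation.Cruxes.HardCoreExtension.NearMinTower.nnnorm_add_sq_le
    _ _

/-- `X ↦ ‖f X‖²` is measurable for a measurable `f`. [folklore] -/
theorem measurable_ennnorm_sq {α : Type*} [MeasurableSpace α] {f : α → ℂ} (hf : Measurable f) :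
    Measurable fun X => (‖f X‖₊ : ℝ≥0∞) ^ 2 :=
  hf.nnnorm.coe_nnreal_ennreal.pow_const _

/-- The first `n` particles of a configuration of `n + 1` particles (measurable projection).
[folklore] -/
theorem measurable_castAddProj (n : ℕ) :
    Measurable fun (X : Config (n + 1)) (i : Fin n) => X (Fin.castAdd 1 i) :=
  measurable_pi_lambda _ fun _ => measurable_pi_apply _

/-- The last particle of a configuration of `n + 1` particles (measurable projection). [folklore] -/
theorem measurable_natAddProj (n : ℕ) :
    Measurable fun (X : Config (n + 1)) (i : Fin 1) => X (Fin.natAdd n i) :=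
  measurable_pi_lambda _ fun _ => measurable_pi_apply _

/-- Integrating a sum of two products of one-block functions over `Λ^{n} × Λ`: the product
integrals split (Fubini, `lintegral_mul_split`). [folklore] -/
theorem lintegral_two_mul_add_split {n : ℕ} {F F' : Config n → ℝ≥0∞} {G G' : Config 1 → ℝ≥0∞}
    (hF : Measurable F) (hF' : Measurable F') (hG : Measurable G) (hG' : Measurable G') :
    ∫⁻ X : Config (n + 1),
        (2 * (F (fun i => X (Fin.castAdd 1 i)) * G (fun i => X (Fin.natAdd n i))) +
          2 * (F' (fun i => X (Fin.castAdd 1 i)) * G' (fun i => X (Fin.natAdd n i)))) =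
      2 * ((∫⁻ Y, F Y) * ∫⁻ Z, G Z) + 2 * ((∫⁻ Y, F' Y) * ∫⁻ Z, G' Z) := by
  have h1 : Measurable fun X : Config (n + 1) =>
      F (fun i => X (Fin.castAdd 1 i)) * G (fun i => X (Fin.natAdd n i)) :=
    (hF.comp (measurable_castAddProj n)).mul (hG.comp (measurable_natAddProj n))
  have h2 : Measurable fun X : Config (n + 1) =>
      F' (fun i => X (Fin.castAdd 1 i)) * G' (fun i => X (Fin.natAdd n i)) :=
    (hF'.comp (measurable_castAddProj n)).mul (hG'.comp (measurable_natAddProj n))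
  rw [lintegral_add_left (h1.const_mul 2), lintegral_const_mul _ h1, lintegral_const_mul _ h2,
    lintegral_mul_split hF hG, lintegral_mul_split hF' hG']

/-! ### Tensor powers of measurable modes -/

/-- `u^{⊗n}` is measurable for a measurable mode `u`. [folklore] -/
theorem measurable_powFun {u : Space → ℂ} (hu : Measurable u) (n : ℕ) :
    Measurable (powFun u n) := by
  show Measurable fun X : Config n => ∏ i, u (X i)
  exact Finset.measurable_prod _ fun i _ => hu.comp (measurable_pi_apply i)

/-- `oneFun u` is measurable for a measurable mode `u`. [folklore] -/
theorem measurable_oneFun {u : Space → ℂ} (hu : Measurable u) : Measurable (oneFun u) :=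
  hu.comp (measurable_pi_apply 0)

/-- `‖ψ₁ ⊗ ψ₂‖² = ‖ψ₁‖² ‖ψ₂‖²` for measurable blocks. [folklore] -/
theorem lintegral_ennnorm_prodFun_sq_of_measurable {n₁ n₂ : ℕ} {ψ₁ : Config n₁ → ℂ}
    {ψ₂ : Config n₂ → ℂ} (h₁ : Measurable ψ₁) (h₂ : Measurable ψ₂) :
    ∫⁻ X, ((‖prodFun ψ₁ ψ₂ X‖₊ : ℝ≥0∞)) ^ 2 =
      (∫⁻ Y, ((‖ψ₁ Y‖₊ : ℝ≥0∞)) ^ 2) * ∫⁻ Z, ((‖ψ₂ Z‖₊ : ℝ≥0∞)) ^ 2 := by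
  simp only [ennnorm_prodFun_sq, fstCLM_apply, sndCLM_apply]
  exact lintegral_mul_split (measurable_ennnorm_sq h₁) (measurable_ennnorm_sq h₂)

/-- `‖u^{⊗n}‖² = 1` for a normalised measurable mode `u`. [folklore] -/
theorem lintegral_powFun_sq_of_measurable {u : Space → ℂ} (hu : Measurable u)
    (h1 : ∫⁻ Y, (‖oneFun u Y‖₊ : ℝ≥0∞) ^ 2 = 1) :
    ∀ n, ∫⁻ X, (‖powFun u n X‖₊ : ℝ≥0∞) ^ 2 = 1
  | 0 => by
      simp only [powFun_zero, nnnorm_one, ENNReal.coe_one, one_pow, lintegral_const, one_mul]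
      simp [volume_pi]
  | n + 1 => by
      rw [powFun_succ, lintegral_ennnorm_prodFun_sq_of_measurable (measurable_powFun hu n)
        (measurable_oneFun hu), lintegral_powFun_sq_of_measurable hu h1 n, h1, one_mul]

/-- **`L²`-continuity of tensor powers.** For normalised measurable modes `a`, `b`:
`‖a^{⊗n} - b^{⊗n}‖² ≤ 4ⁿ ‖a - b‖²` (from `‖a^{⊗(n+1)} - b^{⊗(n+1)}‖² ≤ 2‖a^{⊗n} - b^{⊗n}‖²‖a‖² +
2‖b^{⊗n}‖²‖a - b‖²`). [folklore] -/
theorem lintegral_powFun_sub_sq_le {a b : Space → ℂ} (ha : Measurable a) (hb : Measurable b)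
    (ha1 : ∫⁻ Y, (‖oneFun a Y‖₊ : ℝ≥0∞) ^ 2 = 1) (hb1 : ∫⁻ Y, (‖oneFun b Y‖₊ : ℝ≥0∞) ^ 2 = 1) :
    ∀ n, ∫⁻ X, (‖powFun a n X - powFun b n X‖₊ : ℝ≥0∞) ^ 2 ≤
      4 ^ n * ∫⁻ Y, (‖oneFun a Y - oneFun b Y‖₊ : ℝ≥0∞) ^ 2
  | 0 => by simp [powFun_zero]
  | n + 1 => by
      have ih := lintegral_powFun_sub_sq_le ha hb ha1 hb1 n
      calc ∫⁻ X, (‖powFun a (n + 1) X - powFun b (n + 1) X‖₊ : ℝ≥0∞) ^ 2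
          ≤ ∫⁻ X : Config (n + 1),
              (2 * ((‖powFun a n (fun i => X (Fin.castAdd 1 i)) -
                      powFun b n (fun i => X (Fin.castAdd 1 i))‖₊ : ℝ≥0∞) ^ 2 *
                    (‖oneFun a (fun i => X (Fin.natAdd n i))‖₊ : ℝ≥0∞) ^ 2) +
                2 * ((‖powFun b n (fun i => X (Fin.castAdd 1 i))‖₊ : ℝ≥0∞) ^ 2 *
                    (‖oneFun a (fun i => X (Fin.natAdd n i)) -
                      oneFun b (fun i => X (Fin.natAdd n i))‖₊ : ℝ≥0∞) ^ 2)) := by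
            refine lintegral_mono fun X => ?_
            rw [powFun_succ, powFun_succ]
            simp only [prodFun, fstCLM_apply, sndCLM_apply]
            exact ennnorm_mul_sub_mul_sq_le _ _ _ _
        _ = 2 * ((∫⁻ Y, (‖powFun a n Y - powFun b n Y‖₊ : ℝ≥0∞) ^ 2) *
              ∫⁻ Z, (‖oneFun a Z‖₊ : ℝ≥0∞) ^ 2) +
            2 * ((∫⁻ Y, (‖powFun b n Y‖₊ : ℝ≥0∞) ^ 2) *
              ∫⁻ Z, (‖oneFun a Z - oneFun b Z‖₊ : ℝ≥0∞) ^ 2) :=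
          lintegral_two_mul_add_split
            (measurable_ennnorm_sq ((measurable_powFun ha n).sub (measurable_powFun hb n)))
            (measurable_ennnorm_sq (measurable_powFun hb n))
            (measurable_ennnorm_sq (measurable_oneFun ha))
            (measurable_ennnorm_sq ((measurable_oneFun ha).sub (measurable_oneFun hb)))
        _ ≤ 4 ^ (n + 1) * ∫⁻ Y, (‖oneFun a Y - oneFun b Y‖₊ : ℝ≥0∞) ^ 2 := by
          rw [ha1, mul_one, lintegral_powFun_sq_of_measurable hb hb1 n, one_mul]
          set δ := ∫⁻ Y, (‖oneFun a Y - oneFun b Y‖₊ : ℝ≥0∞) ^ 2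
          have h4 : (1 : ℝ≥0∞) ≤ 4 ^ n := one_le_pow₀ (by norm_num)
          calc 2 * (∫⁻ Y, (‖powFun a n Y - powFun b n Y‖₊ : ℝ≥0∞) ^ 2) + 2 * δ
              ≤ 2 * (4 ^ n * δ) + 2 * (4 ^ n * δ) := by
                gcongr
                calc δ = 1 * δ := (one_mul δ).symm
                  _ ≤ 4 ^ n * δ := by gcongr
            _ = 4 ^ (n + 1) * δ := by ring

/-! ### The power state of a one-particle Dirichlet state -/

section PowerState

variable {N : ℕ} {L : ℝ}

/-- **The power state** `φ^{⊗N}` of a one-particle Dirichlet state `φ` of `Λ_L` exists as a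
Bose-symmetric Dirichlet trial state of `Λ_L` (all `N` particles in the mode `φ`; template:
`BoseGas.powState`, `IdealGasTensorisation.exists_powFun_nearMinimiser`), with free energy
`𝓔₀[φ^{⊗N}] = N · 𝓔₀[φ]`. [folklore] -/
theorem exists_powerState (N : ℕ) (φ : TrialState 1 L) :
    ∃ Ψ : TrialState N L, Ψ.ψ = powFun (fun x => φ.ψ fun _ => x) N ∧
      energy 0 Ψ = N * energy 0 φ := by
  refine ⟨{ ψ := powFun (fun x => φ.ψ fun _ => x) N
            contDiff := contDiff_powFun (contDiff_oneFun_mode φ) N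
            eq_zero := fun X hX => powFun_mode_eq_zero φ hX
            symm := fun σ X => powFun_comp_perm _ σ X
            norm_eq := lintegral_powFun_sq (contDiff_oneFun_mode φ)
              (lintegral_oneFun_mode_sq φ) N }, rfl, ?_⟩
  rw [energy_eq_rawEnergy, energy_eq_rawEnergy]
  show rawEnergy 0 (powFun (fun x => φ.ψ fun _ => x) N) = _
  rw [rawEnergy_zero_powFun (contDiff_oneFun_mode φ) (lintegral_oneFun_mode_sq φ) N, oneFun_mode]

end PowerState

/-! ### Identification of the free ground state -/

/-- **The free Dirichlet ground state is a tensor power.** Let `u ≥ 0` be a measurable real mode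
vanishing off the open box `Λ_L`, `N ≥ 1`, `L > 0`, `e ∈ ℝ`, such that every `N`-body trial state
has free energy `≥ N e` and, for every `ε > 0`, some one-body Dirichlet state `φ` of `Λ_L` has free
energy `≤ e + ε` and `‖φ - u‖² ≤ ε`.  Then `groundState 0 N L = u^{⊗N}` almost everywhere: the
powers `φ^{⊗N}` converge to `u^{⊗N}` in `L²` with energies `→ N e ≤ E₀(N, L)`, so `u^{⊗N}` is a
ground state (`IsGroundState.of_tendstoL2`), and ground states at `v = 0` are unique up to a phase
(`hasUniqueGroundState_of_bounded`), which nonnegativity pins. [folklore] -/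
theorem groundState_ae_eq_prod {N : ℕ} {L : ℝ} (hN : 1 ≤ N) (hL : 0 < L) {u : Space → ℝ}
    (hu : Measurable u) (hu0 : ∀ x, 0 ≤ u x) (hub : ∀ x, x ∉ box L → u x = 0) {e : ℝ}
    (h1 : ∀ Ψ : TrialState N L, ENNReal.ofReal (N * e) ≤ energy 0 Ψ)
    (h2 : ∀ ε : ℝ, 0 < ε → ∃ φ : TrialState 1 L, energy 0 φ ≤ ENNReal.ofReal (e + ε) ∧
      ∫⁻ Y : Config 1, (‖φ.ψ Y - ((u (Y 0) : ℝ) : ℂ)‖₊ : ℝ≥0∞) ^ 2 ≤ ENNReal.ofReal ε) :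
    groundState 0 N L =ᵐ[volume] fun X => ∏ i, u (X i) := by
  -- the approximants `φ k` at `ε = 1/(k+1)` and their powers `Φ k = (φ k)^{⊗N}`
  have hφ : ∀ k : ℕ, ∃ φ : TrialState 1 L,
      energy 0 φ ≤ ENNReal.ofReal (e + 1 / ((k : ℝ) + 1)) ∧
      ∫⁻ Y : Config 1, (‖φ.ψ Y - ((u (Y 0) : ℝ) : ℂ)‖₊ : ℝ≥0∞) ^ 2 ≤
        ENNReal.ofReal (1 / ((k : ℝ) + 1)) := fun k => h2 _ Nat.one_div_pos_of_nat
  choose φ hφE hφD using hφ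
  choose Φ hΦψ hΦE using fun k => exists_powerState (L := L) N (φ k)
  have h0 : Tendsto (fun k : ℕ => ENNReal.ofReal (1 / ((k : ℝ) + 1))) atTop (𝓝 0) := by
    have h := ENNReal.tendsto_ofReal (tendsto_one_div_add_atTop_nhds_zero_nat (𝕜 := ℝ))
    rwa [ENNReal.ofReal_zero] at h
  -- `u` is normalised, being the `L²`-limit of the normalised `φ k`
  have hbm : Measurable fun x => ((u x : ℝ) : ℂ) := Complex.measurable_ofReal.comp hu
  have hb1 : ∫⁻ Y, (‖oneFun (fun x => ((u x : ℝ) : ℂ)) Y‖₊ : ℝ≥0∞) ^ 2 = 1 := by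
    have ht : TendstoL2 φ (oneFun fun x => ((u x : ℝ) : ℂ)) :=
      tendsto_of_tendsto_of_tendsto_of_le_of_le tendsto_const_nhds h0 (fun _ => zero_le)
        fun k => hφD k
    exact ht.lintegral_nnnorm_sq_eq_one (measurable_oneFun hbm).aestronglyMeasurable
  -- energies: `energy (Φ k) = N energy (φ k) ≤ N (e + 1/(k+1)) → N e ≤ E₀ < ⊤`
  have hEΦ : ∀ k, energy 0 (Φ k) ≤ N * ENNReal.ofReal (e + 1 / ((k : ℝ) + 1)) := fun k => by
    rw [hΦE k]
    exact mul_le_mul_right (hφE k) _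
  have hE : groundStateEnergy 0 N L ≠ ⊤ :=
    ne_top_of_le_ne_top (ENNReal.mul_ne_top (ENNReal.natCast_ne_top N) ENNReal.ofReal_ne_top)
      ((groundStateEnergy_le_energy 0 (Φ 0)).trans (hEΦ 0))
  have hlimit : Tendsto (fun k : ℕ => (N : ℝ≥0∞) * ENNReal.ofReal (e + 1 / ((k : ℝ) + 1)))
      atTop (𝓝 (ENNReal.ofReal (N * e))) := by
    have hr : Tendsto (fun k : ℕ => (e + 1 / ((k : ℝ) + 1) : ℝ)) atTop (𝓝 e) := by
      have h := (tendsto_const_nhds (x := e) (f := (atTop : Filter ℕ))).add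
        (tendsto_one_div_add_atTop_nhds_zero_nat (𝕜 := ℝ))
      rwa [add_zero] at h
    have h := ENNReal.Tendsto.const_mul (ENNReal.tendsto_ofReal hr)
      (Or.inr (ENNReal.natCast_ne_top N))
    have hNe : (N : ℝ≥0∞) * ENNReal.ofReal e = ENNReal.ofReal (N * e) := by
      rw [← ENNReal.ofReal_natCast, ← ENNReal.ofReal_mul (Nat.cast_nonneg N)]
    rwa [hNe] at h
  have hlim : liminf (fun k => energy 0 (Φ k)) atTop ≤ groundStateEnergy 0 N L :=
    calc liminf (fun k => energy 0 (Φ k)) atTop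
        ≤ liminf (fun k : ℕ => (N : ℝ≥0∞) * ENNReal.ofReal (e + 1 / ((k : ℝ) + 1))) atTop :=
          liminf_le_liminf (Eventually.of_forall hEΦ)
      _ = ENNReal.ofReal (N * e) := hlimit.liminf_eq
      _ ≤ groundStateEnergy 0 N L := le_iInf h1
  -- `L²`-convergence `Φ k → u^{⊗N}`
  have hdist : ∀ k, ∫⁻ X, (‖(Φ k).ψ X - powFun (fun x => ((u x : ℝ) : ℂ)) N X‖₊ : ℝ≥0∞) ^ 2 ≤
      4 ^ N * ENNReal.ofReal (1 / ((k : ℝ) + 1)) := fun k => by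
    rw [hΦψ k]
    refine (lintegral_powFun_sub_sq_le (continuous_mode (φ k)).measurable hbm
      (lintegral_oneFun_mode_sq (φ k)) hb1 N).trans (mul_le_mul_right ?_ _)
    rw [oneFun_mode]
    exact hφD k
  have htend : TendstoL2 Φ (powFun (fun x => ((u x : ℝ) : ℂ)) N) := by
    refine tendsto_of_tendsto_of_tendsto_of_le_of_le tendsto_const_nhds ?_ (fun _ => zero_le) hdist
    have h := ENNReal.Tendsto.const_mul (a := (4 : ℝ≥0∞) ^ N) h0 (Or.inr (by simp))
    rwa [mul_zero] at h
  -- `u^{⊗N}` is a ground state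
  have hU0 : ∀ X, X ∉ boxN N L → powFun (fun x => ((u x : ℝ) : ℂ)) N X = 0 := fun X hX => by
    have : ∃ i, X i ∉ box L := by simpa [boxN] using hX
    obtain ⟨i, hi⟩ := this
    exact powFun_eq_zero_of_exists _ ⟨i, by rw [hub _ hi, Complex.ofReal_zero]⟩
  have hGS : IsGroundState 0 L (powFun (fun x => ((u x : ℝ) : ℂ)) N) :=
    IsGroundState.of_tendstoL2 (measurable_powFun hbm N) hU0 (fun σ X => powFun_comp_perm _ σ X)
      hE htend hlim
  -- uniqueness up to phase at `v = 0`; the phase is pinned by nonnegativity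
  have hUq : HasUniqueGroundState 0 N L :=
    Theorems.GroundStateRigidity.hasUniqueGroundState_of_bounded N 0 0 L hN measurable_const
      (fun _ => zero_le) hL
  obtain ⟨c, hc, hae⟩ := hUq.exists_ae_eq_groundState hGS
  filter_upwards [hae] with X hX
  have hn := congrArg (fun z : ℂ => ‖z‖) hX
  simp only [norm_mul, hc, one_mul, Complex.norm_real,
    Real.norm_of_nonneg (groundState_nonneg _ _ _ _)] at hn
  rw [← hn, powFun, norm_prod]
  exact Finset.prod_congr rfl fun i _ => by rw [Complex.norm_real, Real.norm_of_nonneg (hu0 _)]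

end FreeGroundState

/-- **Stub S2b — the free Dirichlet ground state is the sine product.** Assuming the sharp free
Dirichlet bound `⟨Ψ, -ΔΨ⟩ ≥ 3N(π/L)²` on the `C¹` core (S1) and the existence of `C¹` one-body
Dirichlet approximants of the sine mode `u_L(x) = ∏ₖ √(2/L) sin(π xₖ/L)` with energies
`≤ 3(π/L)² + ε` and `L²`-distance² `≤ ε` (S2a): for `N ≥ 1`, `L > 0` the nonnegative ground state of
the free gas in `Λ_L` is `u_L^{⊗N}` almost everywhere (`FreeGroundState.groundState_ae_eq_prod` at
`u = u_L`, `e = 3(π/L)²`; `u_L ≥ 0` as `sin(π t/L) ≥ 0` on `(0, L)`).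
[cite: LSSY2005, §1.2 and Ch. 7] -/
theorem stub_freeGroundState :
    (∀ (N : ℕ) (L : ℝ), 0 < L → ∀ Ψ : TrialState N L,
      ENNReal.ofReal (3 * N * (Real.pi / L) ^ 2) ≤ energy 0 Ψ) →
    (∀ (L : ℝ), 0 < L → ∀ ε : ℝ, 0 < ε → ∃ φ : TrialState 1 L,
      energy 0 φ ≤ ENNReal.ofReal (3 * (Real.pi / L) ^ 2 + ε) ∧
      ∫⁻ Y : Config 1, (‖φ.ψ Y -
          ((Set.indicator (box L)
              (fun x : Space => ∏ k : Fin 3, Real.sqrt (2 / L) * Real.sin (Real.pi * x k / L)) (Y 0) : ℝ) : ℂ)‖₊ : ℝ≥0∞) ^ 2 ≤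
        ENNReal.ofReal ε) →
    ∀ (N : ℕ) (L : ℝ), 1 ≤ N → 0 < L →
      groundState 0 N L =ᵐ[volume] fun X => ∏ i : Fin N,
        Set.indicator (box L) (fun x : Space => ∏ k : Fin 3, Real.sqrt (2 / L) * Real.sin (Real.pi * x k / L)) (X i) := by
  intro h1 h2 N L hN hL
  refine FreeGroundState.groundState_ae_eq_prod hN hL (e := 3 * (Real.pi / L) ^ 2)
    (u := Set.indicator (box L) fun x : Space =>
      ∏ k : Fin 3, Real.sqrt (2 / L) * Real.sin (Real.pi * x k / L)) ?_ ?_ ?_ ?_ (h2 L hL)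
  · refine Measurable.indicator ?_ (measurableSet_box L)
    exact (by fun_prop : Continuous fun x : Space =>
      ∏ k : Fin 3, Real.sqrt (2 / L) * Real.sin (Real.pi * x k / L)).measurable
  · refine fun x => Set.indicator_nonneg (fun y hy => ?_) x
    refine Finset.prod_nonneg fun k _ => mul_nonneg (Real.sqrt_nonneg _) ?_
    obtain ⟨hy0, hy1⟩ := hy k
    refine Real.sin_nonneg_of_nonneg_of_le_pi (by positivity) ?_
    rw [div_le_iff₀ hL]
    nlinarith [Real.pi_pos]
  · exact fun x hx => Set.indicator_of_notMem hx _
  · intro Ψ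
    have h := h1 N L hL Ψ
    rwa [show (3 * N * (Real.pi / L) ^ 2 : ℝ) = N * (3 * (Real.pi / L) ^ 2) by ring] at h

end Summit.AtomisticToContinuum.BoseEinsteinCondensation.CoupledBaths

end
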